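import Mathlib.NumberTheory.Padics.HeightOneSpectrum
import Literature.NumberTheory.Automorphic.BrandtModule
import Literature.NumberTheory.Automorphic.BrandtMatrixUnitCount
import Literature.NumberTheory.Automorphic.BrandtOrderIdeals
import Literature.NumberTheory.Automorphic.QuaternionDefiniteNorm
import HarnessLib

/-!
# Dictionary between the two Brandt vocabularies of the tree: `BrandtXi.lean` (`Brandt.XiSetup`,
# `Brandt.ClassSet`, `Brandt.weight`, `Brandt.matrix`, `brandtXi`) and `BrandtModule.lean`
# (`EichlerPackage`, `RightIdealClass`, `BrandtData.ofOrder`, `brandtModule`)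

Topic `NumberTheory/Automorphic`. Route `ABC/DefiniteXi` consumes the Brandt module of level
`(N⁺, N⁻)` through **two** Literature files written independently for two of its wanted
definitions: `BrandtXi.lean` (the definite congruence number `brandtXi N⁺ N⁻ λ = Σ w_i φ_i²`,
used by the named fact `PollackWeston2011.thm_6_8_ellipticCurve`) and `BrandtModule.lean` (the
Brandt data `brandtModule N⁺ N⁻ = (Cls O, w, B(·))`, carrying the named facts
`brandtMatrix_weight_symm`, `brandtMatrix_comm`, `brandtMatrix_mul_of_coprime`,
`brandtModule_massFormula`, `nonempty_eichlerPackage`). Both formalise Vignéras I §4 / III §5 /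
Ex. III.5.8 and Gross 1987 §1 over `ℤ`, with the same conventions (right ideals, left
multiplication by `Bˣ`, weights from left orders) but different names and two cosmetic
differences. This file proves that they agree, so that results about either transfer to the
other:

* orders: `leftOrderOf = Brandt.leftOrder`, `rightOrderOf = Brandt.rightOrder` (definitional),
  `IsZOrder ↔ Brandt.IsOrder`, `IsMaximalZOrder ↔ Brandt.IsMaximalOrder`,
  `IsEichlerOrder ↔ Brandt.IsEichlerOrder` (`isEichlerOrder_iff_brandt`);
* ideals: `Brandt.rightIdeals O ⊆ invertibleRightIdeals O` always
  (`isInvertibleRightIdeal_of_mem_rightIdeals`; `BrandtXi` asks the inverse `I'` to be a full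
  lattice with the compatible orders `O_R(I') = O_L(I)`, `O_L(I') = O_R(I)`, `BrandtModule` only
  asks `I I' = O_L(I)`, `I' I = O`), and **equality** for a `ℤ`-order `O` in a division algebra
  (`rightIdeals_eq_invertibleRightIdeals`: from any `I'` the lattice `J = O I' O_L(I)` is a full
  compatible inverse) — in particular in the totally definite quaternion algebras of both
  packages;
* class sets: the induced bijection `Brandt.ClassSet.equivRightIdealClass : Cls O ≃ Cls O`
  (`Quotient.congr`; both relations are `J = b I`, `b ∈ Bˣ`);
* data: along it the weights agree, `(BrandtData.ofOrder O).w (e i) = Brandt.weight O i`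
  (`|Stab(I)| / 2 = |O_L(I)ˣ| / 2`, `BrandtMatrixUnitCount.lean`), and the Brandt matrices agree
  **up to transposition**, `(BrandtData.ofOrder O).T n (e i) (e j) = Brandt.matrix O n j i`
  (`BrandtModule` indexes `B(n)_ij` by (row ideal `I_i` ⊇ sub-ideal in class `j`), `BrandtXi`
  by (class `i` of the sub-ideal, container `I_j`) — the difference between Eichler/Pizer's
  `B(n)` and Voight's `T(n)`, recorded in both module docstrings): `ofOrder_T_eq_transpose_reindex`;
* packages: `Brandt.XiSetup N⁺ N⁻ ≃ {P : EichlerPackage N⁺ N⁻ // N⁻ squarefree}` in the obvious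
  sense (`XiSetup.toEichlerPackage`, `EichlerPackage.toXiSetup`; the two ramification clauses are
  translated by `primesEquiv_dvd_iff : p_v ∣ n ↔ (n) ⊆ v`), so that the existence fact
  `nonempty_eichlerPackage` of `BrandtModule.lean` yields setups for `brandtXi`
  (`nonempty_xiSetup_of_nonempty_eichlerPackage`), and on corresponding packages the two `ξ`
  agree: `EichlerPackage.xi_toXiSetup`
  (`(P.toXiSetup).xi λ = Brandt.xi P.w (eigenLattice (N⁺N⁻) (B(·)ᵀ) λ)`, transport
  `Brandt.xi_eigenLattice_reindex`). The top-level `brandtXi N⁺ N⁻` and `brandtModule N⁺ N⁻` are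
  values on *independently chosen* packages; their comparison as numbers is the (unvendored)
  independence of all choices and is not asserted here.

## References

* M.-F. Vignéras, *Arithmétique des algèbres de quaternions*, LNM 800 (1980), Ch. I §4 (ordres,
  idéaux, inverse), Ch. III §5 and Ex. 5.8 [VignerasLNM800].
* B. H. Gross, *Heights and the special values of L-series* (1987), §1 [Gross1987].
* J. Voight, *Quaternion Algebras*, GTM 288 (2021), (41.1.1), 41.1.3 [Voight2021].
-/

noncomputable section

open scoped Pointwise
open NumberField IsDedekindDomain

universe u

namespace Literature.NumberTheory.Automorphic

/-! ### Orders -/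

section Orders

variable {B : Type u} [Ring B]

/-- The two left orders of the tree are the same submodule (definitional). [folklore] -/
theorem leftOrderOf_eq_leftOrder (I : Submodule ℤ B) : leftOrderOf I = Brandt.leftOrder I := rfl

/-- The two right orders of the tree are the same submodule (definitional). [folklore] -/
theorem rightOrderOf_eq_rightOrder (I : Submodule ℤ B) : rightOrderOf I = Brandt.rightOrder I :=
  rfl

/-- `IsZOrder O ↔ Brandt.IsOrder B O` (same three clauses). [folklore] -/
theorem isZOrder_iff_isOrder {O : Submodule ℤ B} : IsZOrder O ↔ Brandt.IsOrder B O :=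
  ⟨fun h => ⟨h.one_mem, h.mul_mem, h.isFullLattice⟩, fun h => ⟨h.one_mem, h.mul_mem, h.isFullLattice⟩⟩

/-- `IsMaximalZOrder O ↔ Brandt.IsMaximalOrder B O`. [folklore] -/
theorem isMaximalZOrder_iff_isMaximalOrder {O : Submodule ℤ B} :
    IsMaximalZOrder O ↔ Brandt.IsMaximalOrder B O := by
  simp only [IsMaximalZOrder, Brandt.IsMaximalOrder, isZOrder_iff_isOrder]

/-- **The two notions of Eichler order of level `N` coincide**:
`IsEichlerOrder O N ↔ Brandt.IsEichlerOrder B O N` (both: `O = O₁ ∩ O₂`, `O₁, O₂` maximal,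
`[O₁ : O] = N`). [folklore] -/
theorem isEichlerOrder_iff_brandt {O : Submodule ℤ B} {N : ℕ} :
    IsEichlerOrder O N ↔ Brandt.IsEichlerOrder B O N := by
  simp only [IsEichlerOrder, Brandt.IsEichlerOrder, isMaximalZOrder_iff_isMaximalOrder]

end Orders

/-! ### Invertible right ideals -/

section Ideals

variable {B : Type u} [Ring B]

/-- An element of `Brandt.rightIdeals O` is an `IsInvertibleRightIdeal O` (forget the fullness of
the inverse and the compatibility of orders). [folklore] -/
theorem isInvertibleRightIdeal_of_mem_rightIdeals {O I : Submodule ℤ B}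
    (h : I ∈ Brandt.rightIdeals O) : IsInvertibleRightIdeal O I := by
  obtain ⟨hfull, hright, I', -, h1, -, h3, -⟩ := h
  exact ⟨hfull, hright, I', h1, h3.trans hright⟩

/-- `I · O_R(I) = I`. [folklore] -/
theorem Brandt.mul_rightOrder_self (I : Submodule ℤ B) : I * Brandt.rightOrder I = I := by
  refine le_antisymm (Submodule.mul_le.mpr fun m hm x hx => hx m hm) fun m hm => ?_
  rw [← mul_one m]
  exact Submodule.mul_mem_mul hm (Brandt.one_mem_rightOrder I)

/-- `O_L(I) · I = I`. [folklore] -/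
theorem Brandt.leftOrder_mul_self (I : Submodule ℤ B) : Brandt.leftOrder I * I = I := by
  refine le_antisymm (Submodule.mul_le.mpr fun x hx m hm => hx m hm) fun m hm => ?_
  rw [← one_mul m]
  exact Submodule.mul_mem_mul (Brandt.one_mem_leftOrder I) hm

/-- `O_R(N) ⊆ O_R(M N)`. [folklore] -/
theorem Brandt.rightOrder_le_rightOrder_mul (M N : Submodule ℤ B) :
    Brandt.rightOrder N ≤ Brandt.rightOrder (M * N) := fun x hx y hy =>
  Submodule.mul_induction_on hy
    (fun m hm n hn => by
      rw [mul_assoc]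
      exact Submodule.mul_mem_mul hm (hx n hn))
    (fun a b ha hb => by
      rw [add_mul]
      exact add_mem ha hb)

/-- `O_L(M) ⊆ O_L(M N)`. [folklore] -/
theorem Brandt.leftOrder_le_leftOrder_mul (M N : Submodule ℤ B) :
    Brandt.leftOrder M ≤ Brandt.leftOrder (M * N) := fun x hx y hy =>
  Submodule.mul_induction_on hy
    (fun m hm n hn => by
      rw [← mul_assoc]
      exact Submodule.mul_mem_mul (hx m hm) hn)
    (fun a b ha hb => by
      rw [mul_add]
      exact add_mem ha hb)

/-- **In a division algebra the two notions of invertible right `O`-ideal coincide** (`O` a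
`ℤ`-order): from lattices `I'` with `I I' = O_L(I)`, `I' I = O` one gets the full lattice
`J = O I' O_L(I)` with `I J = O_L(I)`, `J I = O`, `O_R(J) = O_L(I)`, `O_L(J) = O = O_R(I)`, i.e. an
inverse in the sense of `Brandt.IsInvertible` (Vignéras I §4 Lemme 4.3 (3): the inverse of an
ideal is an ideal with these orders). [cite: VignerasLNM800, Ch. I §4 Lemme 4.3] -/
theorem mem_rightIdeals_of_isInvertibleRightIdeal [Nontrivial B] [IsAddTorsionFree B]
    (hdiv : ∀ x : B, x ≠ 0 → IsUnit x) {O I : Submodule ℤ B} (hO : IsZOrder O)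
    (h : IsInvertibleRightIdeal O I) : I ∈ Brandt.rightIdeals O := by
  obtain ⟨I', h1, h2⟩ := h.exists_inv
  have hfull : IsFullLattice B I := h.isFullLattice
  have hright : Brandt.rightOrder I = O := h.rightOrderOf_eq
  have h1' : I * I' = Brandt.leftOrder I := h1
  set Λ := Brandt.leftOrder I with hΛdef
  have hΛ : Brandt.IsOrder B Λ := Brandt.isOrder_leftOrder hfull
  have hOo : Brandt.IsOrder B O := isZOrder_iff_isOrder.mp hO
  have hIO : I * O = I := by rw [← hright]; exact Brandt.mul_rightOrder_self I
  have hΛI : Λ * I = I := Brandt.leftOrder_mul_self I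
  -- the repaired inverse
  set J := O * I' * Λ with hJdef
  have hIJ : I * J = Λ := by
    rw [hJdef, ← mul_assoc, ← mul_assoc, hIO, h1', hΛ.mul_self]
  have hJI : J * I = O := by
    rw [hJdef, mul_assoc, hΛI, mul_assoc, h2, hOo.mul_self]
  have hJΛ : J * Λ = J := by rw [hJdef, mul_assoc, hΛ.mul_self]
  have hOJ : O * J = J := by rw [hJdef, ← mul_assoc, ← mul_assoc, hOo.mul_self]
  have hRJ : Brandt.rightOrder J = Λ := by
    refine le_antisymm ?_ fun x hx j hj => ?_
    · calc Brandt.rightOrder J ≤ Brandt.rightOrder (I * J) := Brandt.rightOrder_le_rightOrder_mul I J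
        _ = Λ := by rw [hIJ, hΛ.rightOrder_eq]
    · rw [← hJΛ]
      exact Submodule.mul_mem_mul hj hx
  have hLJ : Brandt.leftOrder J = O := by
    refine le_antisymm ?_ fun x hx j hj => ?_
    · calc Brandt.leftOrder J ≤ Brandt.leftOrder (J * I) := Brandt.leftOrder_le_leftOrder_mul J I
        _ = O := by rw [hJI, hOo.leftOrder_eq]
    · rw [← hOJ]
      exact Submodule.mul_mem_mul hx hj
  -- `I'` is finitely generated: `I' ⊆ i⁻¹ Λ` for a non-zero (hence invertible) `i ∈ I`
  obtain ⟨n, hn, hn1⟩ := hfull.2 1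
  have hi0 : (n • (1 : B)) ≠ 0 := smul_ne_zero hn one_ne_zero
  obtain ⟨u, hu⟩ := hdiv _ hi0
  have hI'le : I' ≤ u⁻¹ • Λ := fun a ha => by
    rw [mem_units_smul_submodule_iff, inv_inv, Units.smul_def, smul_eq_mul, hu, ← h1']
    exact Submodule.mul_mem_mul hn1 ha
  have hI'fg : I'.FG :=
    Submodule.FG.of_le (Brandt.isFullLattice_units_smul hΛ.isFullLattice u⁻¹).1 hI'le
  -- `I' ≠ 0`, so it contains a unit `w`
  have hI'ne : ∃ a ∈ I', a ≠ 0 := by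
    by_contra hcon
    push Not at hcon
    have hbot : I' = ⊥ := (Submodule.eq_bot_iff I').mpr hcon
    have h1O : (1 : B) ∈ O := hO.one_mem
    rw [← h2, hbot, Submodule.bot_mul] at h1O
    exact one_ne_zero ((Submodule.mem_bot ℤ).mp h1O)
  obtain ⟨a, haI', ha0⟩ := hI'ne
  obtain ⟨w, hw⟩ := hdiv a ha0
  have hJfull : IsFullLattice B J := by
    refine ⟨(hOo.isFullLattice.1.mul hI'fg).mul hΛ.isFullLattice.1, fun d => ?_⟩
    obtain ⟨m, hm, hmd⟩ := hOo.isFullLattice.2 (d * ((w⁻¹ : Bˣ) : B))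
    refine ⟨m, hm, ?_⟩
    have : m • d = (m • (d * ((w⁻¹ : Bˣ) : B))) * a * 1 := by
      rw [mul_one, smul_mul_assoc, mul_assoc, ← hw, Units.inv_mul, mul_one]
    rw [this, hJdef]
    exact Submodule.mul_mem_mul (Submodule.mul_mem_mul hmd haI') (Brandt.one_mem_leftOrder I)
  exact ⟨hfull, hright, J, hJfull, hIJ, hRJ.symm, hJI.trans hright.symm, hLJ.trans hright.symm⟩

/-- **`Brandt.rightIdeals O = invertibleRightIdeals O`** for a `ℤ`-order `O` in a division
algebra (additively torsion-free, e.g. over `ℚ`). [cite: VignerasLNM800, Ch. I §4 Lemme 4.3] -/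
theorem rightIdeals_eq_invertibleRightIdeals [Nontrivial B] [IsAddTorsionFree B]
    (hdiv : ∀ x : B, x ≠ 0 → IsUnit x) {O : Submodule ℤ B} (hO : IsZOrder O) :
    Brandt.rightIdeals O = invertibleRightIdeals O :=
  Set.ext fun _ => ⟨isInvertibleRightIdeal_of_mem_rightIdeals,
    mem_rightIdeals_of_isInvertibleRightIdeal hdiv hO⟩

end Ideals

/-! ### Class sets, weights and Brandt matrices -/

section Classes

variable {B : Type u} [Ring B] {O : Submodule ℤ B}

/-- **The two class sets agree**: when `Brandt.rightIdeals O = invertibleRightIdeals O` (e.g.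
`rightIdeals_eq_invertibleRightIdeals`), the identity on ideals induces
`Brandt.ClassSet O ≃ RightIdealClass O` (both quotients are by `I ∼ b I`, `b ∈ Bˣ`). [folklore] -/
def Brandt.ClassSet.equivRightIdealClass (h : Brandt.rightIdeals O = invertibleRightIdeals O) :
    Brandt.ClassSet O ≃ RightIdealClass O :=
  Quotient.congr (Equiv.setCongr h) fun _ _ => Iff.rfl

/-- The bijection of class sets on classes of ideals: `[I] ↦ [I]`. [folklore] -/
theorem Brandt.ClassSet.equivRightIdealClass_mk (h : Brandt.rightIdeals O = invertibleRightIdeals O)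
    (I : Brandt.rightIdeals O) :
    Brandt.ClassSet.equivRightIdealClass h (Quotient.mk (Brandt.rightClassSetoid O) I) =
      RightIdealClass.mk ⟨I, h ▸ I.2⟩ :=
  rfl

/-- `[M] = [J] ↔ M = α J` for some unit `α` (the class condition of `subidealCount` versus the
translate condition of `Brandt.matrix`). [folklore] -/
theorem RightIdealClass.mk_eq_mk_iff_exists_eq_smul (M J : invertibleRightIdeals O) :
    RightIdealClass.mk M = RightIdealClass.mk J ↔
      ∃ α : Bˣ, (M : Submodule ℤ B) = α • (J : Submodule ℤ B) := by
  rw [RightIdealClass.mk_eq_mk_iff]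
  constructor
  · rintro ⟨b, hb⟩
    exact ⟨b⁻¹, by rw [hb, inv_smul_smul]⟩
  · rintro ⟨α, hα⟩
    exact ⟨α⁻¹, by rw [hα, inv_smul_smul]⟩

/-- **The Brandt matrices agree up to transposition**, entrywise on classes of ideals:
`subidealCount O I n [J] = #{M ⊆ I : [I : M] = n², M = α J}` — the count of `BrandtModule`
(invertible sub-ideals of `I` in the class of `J`) is the count of `BrandtXi` (translates of `J`
inside `I`). [folklore] -/
theorem subidealCount_eq_ncard (I : Submodule ℤ B) (n : ℕ) (J : invertibleRightIdeals O) :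
    subidealCount O I n (RightIdealClass.mk J) =
      {M : Submodule ℤ B | M ≤ I ∧ M.toAddSubgroup.relIndex I.toAddSubgroup = n ^ 2 ∧
        ∃ α : Bˣ, M = α • (J : Submodule ℤ B)}.ncard := by
  unfold subidealCount
  rw [← Nat.card_coe_set_eq]
  refine Nat.card_congr
    { toFun := fun M => ⟨M.1.1, M.2.1, M.2.2.1,
        (RightIdealClass.mk_eq_mk_iff_exists_eq_smul M.1 J).mp M.2.2.2⟩
      invFun := fun M => ⟨⟨M.1, ?_⟩, M.2.1, M.2.2.1,
        (RightIdealClass.mk_eq_mk_iff_exists_eq_smul _ J).mpr M.2.2.2⟩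
      left_inv := fun M => rfl
      right_inv := fun M => rfl }
  obtain ⟨α, hα⟩ := M.2.2.2
  rw [mem_invertibleRightIdeals_iff, hα]
  exact J.2.units_smul α

end Classes

section Quaternion

variable {B : Type u} [Ring B] [Algebra ℚ B] [IsQuaternionAlgebra ℚ B]

/-- `1 ≠ -1` in a quaternion algebra over `ℚ`. [folklore] -/
theorem IsQuaternionAlgebra.one_ne_neg_one_rat : (1 : B) ≠ -1 := by
  haveI : Nontrivial B := Module.nontrivial_of_finrank_pos (R := ℚ)
    (by rw [IsQuaternionAlgebra.finrank_eq_four (K := ℚ) (D := B)]; norm_num)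
  intro h
  have h2 : (2 : B) = 0 := by
    have : (1 : B) + 1 = 0 := by
      nth_rw 2 [h]
      exact add_neg_cancel 1
    rw [← this, one_add_one_eq_two]
  have h2' : algebraMap ℚ B 2 = 0 := by rw [map_ofNat, h2]
  rw [map_eq_zero_iff _ (algebraMap ℚ B).injective] at h2'
  exact two_ne_zero h2'

/-- In a totally definite quaternion algebra over `ℚ` the two sets of invertible right ideals of a
`ℤ`-order agree. [folklore] -/
theorem rightIdeals_eq_invertibleRightIdeals_of_isTotallyDefinite (hdef : IsTotallyDefinite ℚ B)
    {O : Submodule ℤ B} (hO : IsZOrder O) : Brandt.rightIdeals O = invertibleRightIdeals O :=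
  haveI : Nontrivial B := Module.nontrivial_of_finrank_pos (R := ℚ)
    (by rw [IsQuaternionAlgebra.finrank_eq_four (K := ℚ) (D := B)]; norm_num)
  haveI : IsAddTorsionFree B := isAddTorsionFree_of_charZero_module ℚ B
  rightIdeals_eq_invertibleRightIdeals (fun _ hx => isUnit_of_isTotallyDefinite B hdef hx) hO

/-- **The weights agree**: along `e : Brandt.ClassSet O ≃ RightIdealClass O`,
`(BrandtData.ofOrder O).w (e i) = Brandt.weight O i` — `|Stab_{Bˣ}(I)| / 2 = |O_L(I)ˣ| / 2`
(`Brandt.card_stabilizer_eq_two_mul_unitIndex`; both sides are class functions,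
`BrandtData.ofOrder_w_mk`, `Brandt.weight_mk`). [folklore] -/
theorem BrandtData.ofOrder_w_equivRightIdealClass {O : Submodule ℤ B} (hO : IsZOrder O)
    (h : Brandt.rightIdeals O = invertibleRightIdeals O) (i : Brandt.ClassSet O) :
    (BrandtData.ofOrder O hO).w (Brandt.ClassSet.equivRightIdealClass h i) = Brandt.weight O i := by
  induction i using Quotient.inductionOn with
  | h I =>
    rw [Brandt.ClassSet.equivRightIdealClass_mk, BrandtData.ofOrder_w_mk, Brandt.weight_mk,
      Brandt.card_stabilizer_eq_two_mul_unitIndex IsQuaternionAlgebra.one_ne_neg_one_rat,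
      Nat.mul_div_cancel_left _ two_pos]

/-- **The Brandt matrices agree up to transposition**: along `e`,
`(BrandtData.ofOrder O).T n (e i) (e j) = Brandt.matrix O n j i`. [folklore] -/
theorem BrandtData.ofOrder_T_equivRightIdealClass {O : Submodule ℤ B} (hO : IsZOrder O)
    (h : Brandt.rightIdeals O = invertibleRightIdeals O) (n : ℕ) (i j : Brandt.ClassSet O) :
    (BrandtData.ofOrder O hO).T n (Brandt.ClassSet.equivRightIdealClass h i)
        (Brandt.ClassSet.equivRightIdealClass h j) = Brandt.matrix O n j i := by
  induction i using Quotient.inductionOn with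
  | h I =>
    induction j using Quotient.inductionOn with
    | h J =>
      rw [Brandt.ClassSet.equivRightIdealClass_mk, Brandt.ClassSet.equivRightIdealClass_mk,
        BrandtData.ofOrder_T_mk, Brandt.matrix_apply_eq_ncard, subidealCount_eq_ncard]

/-- Matrix form: `(BrandtData.ofOrder O).T n = ((Brandt.matrix O n) reindexed along `e`)ᵀ`. [folklore] -/
theorem BrandtData.ofOrder_T_eq_transpose_reindex {O : Submodule ℤ B} (hO : IsZOrder O)
    (h : Brandt.rightIdeals O = invertibleRightIdeals O) (n : ℕ) :
    (BrandtData.ofOrder O hO).T n =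
      (Matrix.reindex (Brandt.ClassSet.equivRightIdealClass h)
        (Brandt.ClassSet.equivRightIdealClass h) (Brandt.matrix O n)).transpose := by
  ext a b
  rw [Matrix.transpose_apply, Matrix.reindex_apply, Matrix.submatrix_apply,
    ← BrandtData.ofOrder_T_equivRightIdealClass hO h n, Equiv.apply_symm_apply,
    Equiv.apply_symm_apply]

/-- The weights, as a function: `(BrandtData.ofOrder O).w = Brandt.weight O ∘ e⁻¹`. [folklore] -/
theorem BrandtData.ofOrder_w_eq_comp {O : Submodule ℤ B} (hO : IsZOrder O)
    (h : Brandt.rightIdeals O = invertibleRightIdeals O) :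
    (BrandtData.ofOrder O hO).w = Brandt.weight O ∘ (Brandt.ClassSet.equivRightIdealClass h).symm := by
  funext a
  rw [Function.comp_apply, ← BrandtData.ofOrder_w_equivRightIdealClass hO h,
    Equiv.apply_symm_apply]

end Quaternion

/-! ### Packages: `Brandt.XiSetup` versus `EichlerPackage` -/

section Packages

/-- Dictionary between the two ways of saying "`v` lies over a prime dividing `n`":
`p_v ∣ n ↔ (n) ⊆ v` (`p_v = Rat.HeightOneSpectrum.primesEquiv v`, the positive generator of
`v ∩ ℤ`). [folklore] -/
theorem primesEquiv_dvd_iff (v : HeightOneSpectrum (𝓞 ℚ)) (n : ℕ) :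
    ((Rat.HeightOneSpectrum.primesEquiv v : Nat.Primes) : ℕ) ∣ n ↔ ((n : ℕ) : 𝓞 ℚ) ∈ v.asIdeal := by
  show Rat.HeightOneSpectrum.natGenerator v ∣ n ↔ _
  rw [Rat.HeightOneSpectrum.natGenerator_dvd_iff, ← Ideal.comap_symm, Ideal.mem_comap,
    map_natCast]

variable {Nplus Nminus : ℕ}

/-- **A Brandt setup is an Eichler package** (same algebra, same order; the ramification clause
translated by `primesEquiv_dvd_iff`, the Eichler clause by `isEichlerOrder_iff_brandt`). [folklore] -/
def Brandt.XiSetup.toEichlerPackage (S : Brandt.XiSetup Nplus Nminus) :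
    EichlerPackage Nplus Nminus where
  B := S.D
  isTotallyDefinite := S.isTotallyDefinite
  mem_ramifiedPlaces_iff v := by
    rw [S.ramifiedPlaces_eq, Set.mem_setOf_eq, primesEquiv_dvd_iff]
  O := S.O
  isEichlerOrder := isEichlerOrder_iff_brandt.mpr S.isEichlerOrder

/-- **An Eichler package with `N⁻` squarefree is a Brandt setup.** [folklore] -/
def EichlerPackage.toXiSetup (P : EichlerPackage Nplus Nminus) (hsq : Squarefree Nminus) :
    Brandt.XiSetup Nplus Nminus where
  D := P.B
  isTotallyDefinite := P.isTotallyDefinite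
  squarefree := hsq
  ramifiedPlaces_eq := Set.ext fun v => by
    rw [P.mem_ramifiedPlaces_iff, Set.mem_setOf_eq, primesEquiv_dvd_iff]
  O := P.O
  isEichlerOrder := isEichlerOrder_iff_brandt.mp P.isEichlerOrder

/-- The algebra of `P.toXiSetup` is `P.B` (definitional). [folklore] -/
@[simp] theorem EichlerPackage.toXiSetup_D (P : EichlerPackage Nplus Nminus)
    (hsq : Squarefree Nminus) : (P.toXiSetup hsq).D = P.B := rfl

/-- The order of `P.toXiSetup` is `P.O` (definitional). [folklore] -/
@[simp] theorem EichlerPackage.toXiSetup_O (P : EichlerPackage Nplus Nminus)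
    (hsq : Squarefree Nminus) : (P.toXiSetup hsq).O = P.O := rfl

/-- **Setups exist iff packages exist and `N⁻` is squarefree.** [folklore] -/
theorem Brandt.nonempty_xiSetup_iff :
    Nonempty (Brandt.XiSetup Nplus Nminus) ↔
      Nonempty (EichlerPackage Nplus Nminus) ∧ Squarefree Nminus :=
  ⟨fun ⟨S⟩ => ⟨⟨S.toEichlerPackage⟩, S.squarefree⟩, fun ⟨⟨P⟩, hsq⟩ => ⟨P.toXiSetup hsq⟩⟩

/-- **Existence of Brandt setups at admissible levels, from the named fact
`nonempty_eichlerPackage` of `BrandtModule.lean`**: for `N⁺ ≥ 1` and `N⁻` squarefree with an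
odd number of prime factors, coprime to `N⁺`, there is a `Brandt.XiSetup N⁺ N⁻` — so that
`brandtXi N⁺ N⁻` is not the junk value `0` for lack of a setup. [cite: VignerasLNM800, Ch. III §3 Thm. 3.1, Ch. I §4 Prop. 4.2, Ch. II §2 Lemme 2.4, Ch. III §5 Prop. 5.1] -/
theorem Brandt.nonempty_xiSetup_of_nonempty_eichlerPackage (h : nonempty_eichlerPackage)
    (h0 : 0 < Nplus) (hsq : Squarefree Nminus) (hodd : Odd Nminus.primeFactors.card)
    (hcop : Nat.Coprime Nplus Nminus) : Nonempty (Brandt.XiSetup Nplus Nminus) :=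
  Brandt.nonempty_xiSetup_iff.mpr ⟨h Nplus Nminus h0 hsq hodd hcop, hsq⟩

/-- **The two `ξ` agree on corresponding packages.** For an Eichler package `P` (with `N⁻`
squarefree) and any eigenvalue system `λ`, the congruence number of `BrandtXi.lean` computed on
the setup `P.toXiSetup` equals `Brandt.xi` of the weights of `P.brandtData` and the eigen-lattice
of the *transposed* Brandt matrices `B(n)ᵀ` of `P.brandtData` (transport of `ξ` along the
bijection of class sets, `Brandt.xi_eigenLattice_reindex`; the transpose because `BrandtModule`'s
`B(n)` is `BrandtXi`'s `T(n)ᵀ`). [folklore] -/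
theorem EichlerPackage.xi_toXiSetup (P : EichlerPackage Nplus Nminus) (hsq : Squarefree Nminus)
    (lam : ℕ → ℤ) :
    (P.toXiSetup hsq).xi lam =
      Brandt.xi P.brandtData.w
        (Brandt.eigenLattice (Nplus * Nminus) (fun n => (P.brandtData.T n).transpose) lam) := by
  classical
  have hO : IsZOrder P.O := P.isEichlerOrder.isZOrder
  have h : Brandt.rightIdeals P.O = invertibleRightIdeals P.O :=
    rightIdeals_eq_invertibleRightIdeals_of_isTotallyDefinite P.isTotallyDefinite hO
  set e : Brandt.ClassSet P.O ≃ RightIdealClass P.O := Brandt.ClassSet.equivRightIdealClass h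
    with he
  letI : Fintype (RightIdealClass P.O) := P.brandtData.instFintypeι
  letI : Fintype (Brandt.ClassSet P.O) := Fintype.ofEquiv _ e.symm
  have hT : (fun n => (P.brandtData.T n).transpose) =
      fun n => Matrix.reindex e e (Brandt.matrix P.O n) :=
    funext fun n =>
      (congrArg Matrix.transpose (BrandtData.ofOrder_T_eq_transpose_reindex hO h n)).trans
        (Matrix.transpose_transpose _)
  have hw : P.brandtData.w = Brandt.weight P.O ∘ e.symm := BrandtData.ofOrder_w_eq_comp hO h
  rw [hT, hw]
  exact (Brandt.xiOfOrder_eq P.O (Nplus * Nminus) lam).trans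
    (Brandt.xi_eigenLattice_reindex e (Nplus * Nminus) (Brandt.matrix P.O) (Brandt.weight P.O)
      lam).symm

end Packages

end Literature.NumberTheory.Automorphic

end
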